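/-
Copyright (c) 2026 the pub-hodgecm-mathlib formalisation cell (harness21).  Prover seat hodgecm-mathlib-K2E3-p21 (g4), Track B «K2-LIT» ∕ h413
(`stmt-HodgeConjecture-24833`), line `K2_E3_EllipticInputs`, unit U12 §L, road «GL-[M6]-sc» (line lead K2E3-p23 (g5), RULINGS #3 (M3-3) DEAL 2026-09-04T06:10:28Z,
RULINGS #4 (M4-2) «=»), brick B0c, file 2: «(c) TWIST-TO-DESCEND — every irreducible admissible `r` of `GL₃(F)` has an unramified twist trivial on `ϖ·1`».  2026-09-04.
-/
import Summits.HodgeConjecture.HodgeConjecture.Theorems.K2E3GL3SupercuspidalTwistDescent      -- ★ B0c file 1 p857846 (this seat): `exists_unramified_cubeRoot`, the frame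
import Literature.NumberTheory.Automorphic.SmoothRepresentationCentralCharacterProofs         -- ★ `Representation.exists_hasCentralCharacter_holds` (Schur for admissible irreducibles)
import Literature.NumberTheory.Automorphic.CongruenceSubgroupExpansionGL                       -- ★ `nonarchimedeanGroup_gl`
import Literature.NumberTheory.Automorphic.GLnGelfandKazhdanInvolution                         -- ★ `locallyCompactSpace_generalLinearGroup`
import HarnessLib

/-!
# K2_E3 road (h413), road «GL-[M6]-sc», brick B0c (file 2): (c) twist-to-descend — for `r ∈ Irr(GL₃(F))` admissible there is an UNRAMIFIED character `χ` of `F^×`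
# with `(r ⊗ χ∘det)(ϖ·1) = 1`, so that `r ⊗ χ∘det` descends to `G_Λ = GL₃(F) ⧸ ϖ^ℤ·1` by ★ file 1

Cell `pub/hodgecm-mathlib` (D-0151), Track B, seat K2E3-p21 (g4); line lead K2E3-p23 (g5) (RULINGS #3 (M3-3): «(c) twist-to-descend: `∀ c : IrrClass (GL (Fin 3) F)` (irreducible
admissible; central character exists ★?) `∃ χ` as in (a) with `(r.twist (χ.comp GL.det)).ρ (scalar ϖ·1) = 1`»; RULINGS #4 (M4-2): «on central characters: … say what you find» —
FOUND: ★ `Representation.exists_hasCentralCharacter_holds` (`SmoothRepresentationCentralCharacterProofs`, Schur for admissible irreducibles of a locally compact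
non-archimedean group over an algebraically closed field) — used here with ★ `nonarchimedeanGroup_gl`, ★ `locallyCompactSpace_generalLinearGroup`), dealer K2E3-plan (g3).
`--supports stmt-HodgeConjecture-24833 --as helper`; THEOREMS ONLY (no definition ∕ instance ∕ notation ∕ named fact ∕ `sorry`); never imports `Cruxes/…/Lines`.  COUNT-NEUTRAL.
(d) (`smoothTrace` ∕ «charLocIntNear» under twist) is file 3.

THE MATHEMATICS.  `r` irreducible admissible ⇒ central character `ω` (Schur): `r(ϖ·1) = ω(ϖ·1)·id`.  By ★ (a) pick an unramified `χ` with `χ(ϖ)³ = ω(ϖ·1)⁻¹`; since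
`det(ϖ·1) = ϖ³`, `(r ⊗ χ∘det)(ϖ·1) = χ(ϖ)³ ω(ϖ·1)·id = id`.  `χ∘det` has open kernel (`det` is continuous, `ker χ` open), so `r ⊗ χ∘det` is again a `SmoothIrrep`
(★ `SmoothIrrep.twist`), to which ★ file 1 `exists_smoothIrrep_quotScalar` applies.  [BushnellHenniart2006, §2.6 Cor. 1 (Schur), §9.1 ∕ §11.1 (twists, unramified characters)].

HONEST LABEL: HC_CM is proved only modulo the 7 printed citations (2 remaining named inputs: hLiu418 = stmt-HodgeConjecture-24832, h413 = stmt-HodgeConjecture-24833)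
until rung 0 closes; count-neutral helper.
-/

set_option autoImplicit false
set_option linter.dupNamespace false   -- `Summit.HodgeConjecture.HodgeConjecture.…` (D-0017 nested layout; lakefile exemption for Summits)

noncomputable section

open Filter Topology TopologicalSpace Function
open scoped MatrixGroups WithZero Valued
open Literature.NumberTheory.Automorphic
open Summit.HodgeConjecture.HodgeConjecture.Cruxes.H413.K2E3GL3SupercuspidalTwistDescent

namespace Summit.HodgeConjecture.HodgeConjecture.Cruxes.H413.K2E3GL3SupercuspidalTwistDescentTwist

section Det

variable {F : Type*} [Field F] [TopologicalSpace F] [IsTopologicalRing F]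

/-- `det : GL₃(F) → F^×` is continuous (for the unit topologies). [folklore] -/
theorem continuous_det : Continuous (Matrix.GeneralLinearGroup.det : GL (Fin 3) F → Fˣ) := by
  refine Units.continuous_iff.2 ⟨Units.continuous_val.matrix_det, ?_⟩
  have h : (fun g : GL (Fin 3) F => ((Matrix.GeneralLinearGroup.det g)⁻¹ : Fˣ).val) =
      fun g => (((g⁻¹ : GL (Fin 3) F)) : Matrix (Fin 3) (Fin 3) F).det := by
    funext g; rw [← map_inv, Matrix.GeneralLinearGroup.val_det_apply]
  rw [h]
  exact Units.continuous_coe_inv.matrix_det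

/-- `χ ∘ det` has open kernel when `χ` has. [folklore] -/
theorem isOpen_ker_comp_det {χ : Fˣ →* ℂˣ} (hχ : IsOpen (χ.ker : Set Fˣ)) :
    IsOpen ((χ.comp (Matrix.GeneralLinearGroup.det : GL (Fin 3) F →* Fˣ)).ker : Set (GL (Fin 3) F)) := by
  rw [MonoidHom.comap_ker .. |>.symm, Subgroup.coe_comap]
  exact hχ.preimage continuous_det

omit [TopologicalSpace F] [IsTopologicalRing F] in
/-- `det(c·1) = c³` in `GL₃`. [folklore] -/
theorem det_scalar_eq_pow (c : Fˣ) : Matrix.GeneralLinearGroup.det (Matrix.GeneralLinearGroup.scalar (Fin 3) c) = c ^ 3 :=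
  Units.ext (by
    rw [Matrix.GeneralLinearGroup.val_det_apply, Matrix.GeneralLinearGroup.coe_scalar, Matrix.scalar_apply, Matrix.det_diagonal, Finset.prod_const,
      Finset.card_univ, Fintype.card_fin, Units.val_pow_eq_pow_val])

end Det

section Schur

variable {F : Type*} [Field F] [ValuativeRel F] [TopologicalSpace F] [IsNonarchimedeanLocalField F]

/-- **Central character at a scalar** (Schur, ★ `exists_hasCentralCharacter_holds`): an irreducible ADMISSIBLE `r` of `GL₃(F)` acts on `c·1` by a scalar `ω ∈ ℂ^×`.
[cite: BushnellHenniart2006, §2.6 Cor. 1] -/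
theorem exists_apply_scalar_eq_smul (r : SmoothIrrep (GL (Fin 3) F)) (hr : r.ρ.IsAdmissible) (c : Fˣ) :
    ∃ ω : ℂˣ, r.ρ (Matrix.GeneralLinearGroup.scalar (Fin 3) c) = (ω : ℂ) • (LinearMap.id : r.V →ₗ[ℂ] r.V) := by
  haveI : NonarchimedeanGroup (GL (Fin 3) F) := nonarchimedeanGroup_gl F 3
  haveI : LocallyCompactSpace (GL (Fin 3) F) := locallyCompactSpace_generalLinearGroup F 3
  obtain ⟨ω, hω⟩ := Representation.exists_hasCentralCharacter_holds r.ρ hr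
  have hc : Matrix.GeneralLinearGroup.scalar (Fin 3) c ∈ Subgroup.center (GL (Fin 3) F) :=
    K2E3GL3ModCocompactCentral.map_scalar_le_center (⊤ : Subgroup Fˣ) (Subgroup.mem_map_of_mem _ (Subgroup.mem_top c))
  exact ⟨ω ⟨_, hc⟩, hω ⟨_, hc⟩⟩

end Schur

section Twist

variable {F : Type*} [Field F] [Valued F ℤᵐ⁰] [ValuativeRel F] [IsNonarchimedeanLocalField F]

/-- **(c) TWIST-TO-DESCEND.**  For a uniformiser `ϖ` and an irreducible admissible `r` of `GL₃(F)` there is an UNRAMIFIED character `χ : F^× → ℂ^×` (open kernel,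
trivial on `𝒪^×`) such that the twist `r ⊗ (χ ∘ det)` (★ `SmoothIrrep.twist`, open kernel `hχdet`) is TRIVIAL on `ϖ·1`: `(r ⊗ χ∘det)(ϖ·1) = 1` — so ★ file 1
`exists_smoothIrrep_quotScalar` descends `r ⊗ χ∘det` to `G_Λ`. [cite: BushnellHenniart2006, §2.6 Cor. 1] [cite: BushnellHenniart2006, §11.1] -/
theorem exists_unramified_twist_apply_scalar_eq_one {ϖ : F} (hϖ : Valued.v ϖ = WithZero.exp (-1 : ℤ)) (hϖ0 : ϖ ≠ 0)
    (r : SmoothIrrep (GL (Fin 3) F)) (hr : r.ρ.IsAdmissible) :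
    ∃ (χ : Fˣ →* ℂˣ) (hχdet : IsOpen ((χ.comp (Matrix.GeneralLinearGroup.det : GL (Fin 3) F →* Fˣ)).ker : Set (GL (Fin 3) F))),
      IsOpen (χ.ker : Set Fˣ) ∧ (∀ u : Fˣ, Valued.v (u : F) = 1 → χ u = 1) ∧
        (r.twist (χ.comp Matrix.GeneralLinearGroup.det) hχdet).ρ (Matrix.GeneralLinearGroup.scalar (Fin 3) (Units.mk0 ϖ hϖ0)) = 1 := by
  haveI : IsTopologicalRing F := inferInstance
  obtain ⟨ω, hω⟩ := exists_apply_scalar_eq_smul r hr (Units.mk0 ϖ hϖ0)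
  obtain ⟨χ, hχo, hχu, hχ3⟩ := exists_unramified_cubeRoot hϖ hϖ0 ω⁻¹
  refine ⟨χ, isOpen_ker_comp_det hχo, hχo, hχu, ?_⟩
  rw [SmoothIrrep.ρ_twist]
  show (((χ.comp Matrix.GeneralLinearGroup.det) (Matrix.GeneralLinearGroup.scalar (Fin 3) (Units.mk0 ϖ hϖ0)) : ℂˣ) : ℂ) •
      r.ρ (Matrix.GeneralLinearGroup.scalar (Fin 3) (Units.mk0 ϖ hϖ0)) = 1
  rw [MonoidHom.comp_apply, det_scalar_eq_pow, map_pow, hχ3, hω, smul_smul, Units.val_inv_eq_inv_val, inv_mul_cancel₀ ω.ne_zero, one_smul]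
  rfl

/-- **(c′) the descended twist, packaged**: with `χ` as in (c), the twist `r ⊗ χ∘det` descends to an irreducible smooth representation of `G_Λ` on the same space, supercuspidal ∕
admissible when `r ⊗ χ∘det` is (★ file 1 `exists_smoothIrrep_quotScalar`). [cite: BushnellHenniart2006, §11.1] -/
theorem exists_unramified_twist_descends {ϖ : F} (hϖ : Valued.v ϖ = WithZero.exp (-1 : ℤ)) (hϖ0 : ϖ ≠ 0)
    [((Subgroup.zpowers (Units.mk0 ϖ hϖ0)).map (Matrix.GeneralLinearGroup.scalar (Fin 3))).Normal]
    (r : SmoothIrrep (GL (Fin 3) F)) (hr : r.ρ.IsAdmissible) :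
    ∃ (χ : Fˣ →* ℂˣ) (hχdet : IsOpen ((χ.comp (Matrix.GeneralLinearGroup.det : GL (Fin 3) F →* Fˣ)).ker : Set (GL (Fin 3) F))),
      IsOpen (χ.ker : Set Fˣ) ∧ (∀ u : Fˣ, Valued.v (u : F) = 1 → χ u = 1) ∧
      ∃ r' : SmoothIrrep (GL (Fin 3) F ⧸ (Subgroup.zpowers (Units.mk0 ϖ hϖ0)).map (Matrix.GeneralLinearGroup.scalar (Fin 3))),
        ∃ e : r'.V ≃ₗ[ℂ] (r.twist (χ.comp Matrix.GeneralLinearGroup.det) hχdet).V,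
          (∀ (g : GL (Fin 3) F) (v : r'.V), e (r'.ρ (QuotientGroup.mk g) v) = (r.twist (χ.comp Matrix.GeneralLinearGroup.det) hχdet).ρ g (e v)) ∧
          ((r.twist (χ.comp Matrix.GeneralLinearGroup.det) hχdet).ρ.IsSupercuspidal → r'.ρ.IsSupercuspidal) ∧
          ((r.twist (χ.comp Matrix.GeneralLinearGroup.det) hχdet).ρ.IsAdmissible → r'.ρ.IsAdmissible) := by
  obtain ⟨χ, hχdet, hχo, hχu, h1⟩ := exists_unramified_twist_apply_scalar_eq_one hϖ hϖ0 r hr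
  exact ⟨χ, hχdet, hχo, hχu, exists_smoothIrrep_quotScalar hϖ0 _ h1⟩

end Twist

end Summit.HodgeConjecture.HodgeConjecture.Cruxes.H413.K2E3GL3SupercuspidalTwistDescentTwist

end
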